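import Summits.Ventures.LatticeQCDFlow.Scaling.CompositionProductBracket

/-!
HONEST FRAMING: exact (Metropolis-corrected) sampling algorithms for lattice gauge theory; figures
of merit are autocorrelation/cost numbers at stated couplings and volumes; no continuum-physics
claim.

# UrnProductCertificate — A LAW-FREE MULTIPLICATIVE CERTIFICATE FOR THE URN: WITH `θ = 1/(1 + pW)` AND `Φ = 2 + Σ_v θ_v·(N_X(v) + N_Y(v))`,
# `E_opt[Δ'·Φ'] ≤ (1 − p/(2K+4))·Δ·Φ` FOR EVERY CONTENT TYPE, EVERY PAIR OF LAWS WITH `p·μ_1 ≤ μ_0`, EVERY PAIR OF COMPOSITIONS (lean-2 GEN-35, ours)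

Venture-side (OURS).  Cell `lqcd-flow` (pub-lqcd), unit `pub-lqcd-lean-2-g35`, 2026-08-29.  Chapter V (composition variables), file 6 — the point of the chapter.  The urn of
file 3 (`UrnDeletionCoupling`) is the `τ = ∞` caricature of the refresh cycle of the homogeneous `q`-content star: two copies with full compositions `N_X, N_Y` (`K + 1`
particles each) delete one particle each with probability `∝ N(v)/W(v)` (`W = μ_1/μ_0`, `p·W ≤ 1`) and receive a common fresh `μ_0`-particle.  File 3: under the optimal
coupling the composition distance never increases and `E[Δ'] ≤ (1 − p/min{Z_X,Z_Y})Δ` — law-free `p/(K+1)` unless BOTH copies hold a pool of impersistent particles.  File 5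
(`CompositionProductBracket`): for `Ψ = Δ·Φ`, `Φ = 2 + Σ_v r_v(N_X + N_Y)(v)`, contraction by `1 − ρ` follows from `G(Φ + e − 2r_max) + Δ(R_X + R_Y − e) ≥ ρΔΦ`
(`e = 2E_{μ_0} r`, `R = E r(deleted)`).  HERE the weights are chosen: **`r_v = θ_v = 1/(1 + p·W(v)) ∈ [½, 1]`** (impersistent particles weigh `1`, the most persistent `½`).
The identity `θ_v·(p + 1/W_v) = 1/W_v` gives, copy by copy and in EVERY state, `(p/Z)·M + R = 1` (`M = Σ θN` the mass, `R` the expected deleted weight), while the fresh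
particle weighs on average `E_{μ_0} θ ≤ 1 − p/2` (`Σ μ_0 W = Σ μ_1 = 1`, `1/(1+x) ≤ 1 − x/2`); with `G ≥ pΔ/min Z` the criterion's left side is `≥ Δ·[2 − 2(1 − p/2)] = pΔ`, and
`Φ ≤ 2K + 4`.  Hence **`E_opt[Δ'Φ'] ≤ (1 − p/(2K+4))·ΔΦ`**, with `Δ ≤ Ψ ≤ (2K+4)Δ`: the composition distance of the urn pair is driven to `0` at the law-free rate `p/(2K+4)` per
cycle from `Ψ ≤ (2K+4)(K+1)` — the conjectured order `(K/p)·log K` for OPEN-MATH item 1 (i) at `τ = ∞`, every `q`, every pair of laws, in composition variables.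
Hypothesis-equations, no definitions, no chain.

## What is proved

* §1 `theta_mem` (`½ ≤ θ ≤ 1`), **`theta_key`** (`θ_v·p + θ_v/W_v = 1/W_v`), **`urn_pM_add_R`** (`p·M + Z·R = Z`, i.e. `(p/Z)M + R = 1`), **`theta_fresh_le`**
  (`Σ μ_0 θ ≤ 1 − p/2` from `Σ μ_0 W = 1`, `pW ≤ 1`), `theta_mass_le` (`Σ θ N ≤ Σ N`).
* §2 **`urn_product_criterion`** — the criterion of file 5 holds with `ρ = p/(2K+4)`: `ρΔΦ ≤ G(Φ + e − 2) + Δ(R_X + R_Y − e)`.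
* §3 **`urn_product_certificate`** — `Σ_{a,b} q(a,b)·Δ(M^a_X,M^b_Y)·(Φ + e − θ_a − θ_b) ≤ (1 − p/(2K+4))·Δ(N_X,N_Y)·Φ` for the optimal coupling `q`; `urn_product_sandwich`
  (`Δ ≤ ΔΦ ≤ (2K+4)Δ`).

Reading (no numerics implied): this is the `τ = ∞` end of the fast-swap regime; at finite swap odds the same potential with a hub term `s(z)` is what the toy certifies
(`lean-2/work-gen35/numerics/cyclehub.py bil`, κ ≈ 0.4–1.0 in units `(p/K)min{1,τ}`, NOTHING CLAIMED), and files 2, 4, 5 are the bookkeeping for proving it.  NOT CLAIMED: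
anything at finite `τ`; the lumped-chain plumbing from this one-cycle inequality to `t_mix`.  Literature grade (cell rule): OWN, elementary; nothing cited as a fact; no new bib keys.
-/

open Finset
open Literature.Probability.MarkovChains

namespace Summit.Ventures.LatticeQCDFlow.Scaling

section UrnProduct
variable {S : Type*} [Fintype S] [DecidableEq S]
variable {Δ : (S → ℕ) → (S → ℕ) → ℕ} {W θ μ0 : S → ℝ} {p ZX ZY : ℝ} {NX NY : S → ℕ} {uX uY : S → ℝ}

/-! ## §1 The weight `θ = 1/(1 + pW)` -/

omit [Fintype S] [DecidableEq S] in
/-- `½ ≤ θ_v ≤ 1` (from `0 ≤ pW ≤ 1`). [ours] -/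
theorem theta_mem (hW : ∀ v, 0 < W v) (hp0 : 0 ≤ p) (hp : ∀ v, p * W v ≤ 1) (hθ : ∀ v, θ v = 1 / (1 + p * W v)) (v : S) :
    1 / 2 ≤ θ v ∧ θ v ≤ 1 := by
  have h0 : 0 ≤ p * W v := mul_nonneg hp0 (hW v).le
  rw [hθ]
  constructor
  · rw [div_le_div_iff₀ (by norm_num) (by linarith)]; linarith [hp v]
  · rw [div_le_one (by linarith)]; linarith

omit [Fintype S] [DecidableEq S] in
/-- **The key identity:** `θ_v·p + θ_v/W_v = 1/W_v`. [ours] -/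
theorem theta_key (hW : ∀ v, 0 < W v) (hp0 : 0 ≤ p) (hθ : ∀ v, θ v = 1 / (1 + p * W v)) (v : S) :
    θ v * p + θ v / W v = 1 / W v := by
  have hWv := hW v
  have h1 : 0 < 1 + p * W v := by have := mul_nonneg hp0 hWv.le; linarith
  rw [hθ]
  field_simp
  ring

omit [DecidableEq S] in
/-- **`p·M + Z·R = Z`:** `p·Σ_v θ_v N(v) + Σ_v θ_v N(v)/W(v) = Σ_v N(v)/W(v)` — per copy, the `p`-weighted mass plus the expected deleted weight (times `Z`) is exactly `Z`. [ours] -/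
theorem urn_pM_add_R (hW : ∀ v, 0 < W v) (hp0 : 0 ≤ p) (hθ : ∀ v, θ v = 1 / (1 + p * W v)) (N : S → ℕ) :
    p * ∑ v, θ v * (N v : ℝ) + ∑ v, θ v * (N v : ℝ) / W v = ∑ v, (N v : ℝ) / W v := by
  rw [mul_sum, ← sum_add_distrib]
  refine sum_congr rfl fun v _ => ?_
  have h := theta_key hW hp0 hθ v
  have hWv := (hW v).ne'
  calc p * (θ v * (N v : ℝ)) + θ v * (N v : ℝ) / W v = (θ v * p + θ v / W v) * (N v : ℝ) := by ring
    _ = 1 / W v * (N v : ℝ) := by rw [h]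
    _ = (N v : ℝ) / W v := by ring

omit [DecidableEq S] in
/-- **The fresh particle is lighter on average:** `Σ_v μ_0(v)θ_v ≤ 1 − p/2` (`μ_0 ≥ 0`, `Σ μ_0 = 1`, `Σ μ_0 W = 1`, `pW ≤ 1`; `1/(1+x) ≤ 1 − x/2` on `[0,1]`). [ours] -/
theorem theta_fresh_le (hW : ∀ v, 0 < W v) (hp0 : 0 ≤ p) (hp : ∀ v, p * W v ≤ 1) (hθ : ∀ v, θ v = 1 / (1 + p * W v))
    (hμ0 : ∀ v, 0 ≤ μ0 v) (hμ1 : ∑ v, μ0 v = 1) (hμW : ∑ v, μ0 v * W v = 1) :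
    ∑ v, μ0 v * θ v ≤ 1 - p / 2 := by
  have hpt : ∀ v, μ0 v * θ v ≤ μ0 v * (1 - p * W v / 2) := by
    intro v
    refine mul_le_mul_of_nonneg_left ?_ (hμ0 v)
    have h0 : 0 ≤ p * W v := mul_nonneg hp0 (hW v).le
    rw [hθ, div_le_iff₀ (by linarith)]
    nlinarith [hp v, h0]
  calc ∑ v, μ0 v * θ v ≤ ∑ v, μ0 v * (1 - p * W v / 2) := sum_le_sum fun v _ => hpt v
    _ = ∑ v, μ0 v - (p / 2) * ∑ v, μ0 v * W v := by rw [mul_sum, ← sum_sub_distrib]; exact sum_congr rfl fun v _ => by ring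
    _ = 1 - p / 2 := by rw [hμ1, hμW, mul_one]

omit [DecidableEq S] in
/-- `0 ≤ Σ θ N ≤ Σ N`. [ours] -/
theorem theta_mass_le (hW : ∀ v, 0 < W v) (hp0 : 0 ≤ p) (hp : ∀ v, p * W v ≤ 1) (hθ : ∀ v, θ v = 1 / (1 + p * W v)) (N : S → ℕ) :
    0 ≤ ∑ v, θ v * (N v : ℝ) ∧ ∑ v, θ v * (N v : ℝ) ≤ ∑ v, (N v : ℝ) := by
  have hm := theta_mem hW hp0 hp hθ
  refine ⟨sum_nonneg fun v _ => mul_nonneg (by linarith [(hm v).1]) (Nat.cast_nonneg _), sum_le_sum fun v _ => ?_⟩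
  calc θ v * (N v : ℝ) ≤ 1 * (N v : ℝ) := mul_le_mul_of_nonneg_right (hm v).2 (Nat.cast_nonneg _)
    _ = (N v : ℝ) := one_mul _

/-! ## §2 The criterion of file 5 holds with `ρ = p/(2K+4)` -/

/-- **THE CRITERION.**  Urn laws, optimal coupling, `θ = 1/(1+pW)`, `Φ = 2 + M_X + M_Y`, `e = 2Σ μ_0 θ`, equal totals `Σ N_X = Σ N_Y = K + 1`:
`(p/(2K+4))·Δ·Φ ≤ G·(Φ + e − 2) + Δ·(R_X + R_Y − e)` with `G = Δ − E_opt Δ'`. [ours] -/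
theorem urn_product_criterion (hΔ : ∀ N N', Δ N N' = ∑ v, (N v - N' v)) (MX MY : S → S → ℕ) (hW : ∀ v, 0 < W v) (hp0 : 0 ≤ p) (hp : ∀ v, p * W v ≤ 1)
    (hθ : ∀ v, θ v = 1 / (1 + p * W v)) (hμ0 : ∀ v, 0 ≤ μ0 v) (hμ1 : ∑ v, μ0 v = 1) (hμW : ∑ v, μ0 v * W v = 1)
    (hZX : ZX = ∑ v, (NX v : ℝ) / W v) (hZY : ZY = ∑ v, (NY v : ℝ) / W v) (hZX0 : 0 < ZX) (hZY0 : 0 < ZY)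
    (huX : ∀ v, uX v = (NX v : ℝ) / W v / ZX) (huY : ∀ v, uY v = (NY v : ℝ) / W v / ZY) {K : ℕ} (hKX : ∑ v, NX v = K + 1) (hKY : ∑ v, NY v = K + 1)
    (hMX : ∀ a, uX a ≠ 0 → NX = MX a + Pi.single a 1) (hMY : ∀ b, uY b ≠ 0 → NY = MY b + Pi.single b 1) :
    p / (2 * K + 4) * (Δ NX NY : ℝ) * (2 + ∑ v, θ v * (NX v : ℝ) + ∑ v, θ v * (NY v : ℝ))
      ≤ ((Δ NX NY : ℝ) - ∑ a, ∑ b, optimalCoupling uX uY a b * (Δ (MX a) (MY b) : ℝ))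
          * ((2 + ∑ v, θ v * (NX v : ℝ) + ∑ v, θ v * (NY v : ℝ)) + 2 * ∑ v, μ0 v * θ v - 2 * 1)
        + (Δ NX NY : ℝ) * (∑ a, uX a * θ a + ∑ b, uY b * θ b - 2 * ∑ v, μ0 v * θ v) := by
  have htot : ∑ v, NX v = ∑ v, NY v := by rw [hKX, hKY]
  -- the gain of the optimal coupling is the gain `G` of file 2, `≥ pΔ/min Z`
  have hG : p * (Δ NX NY : ℝ) / min ZX ZY ≤ (Δ NX NY : ℝ) - ∑ a, ∑ b, optimalCoupling uX uY a b * (Δ (MX a) (MY b) : ℝ) := by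
    rw [hubBracket_optimal' hΔ NX NY MX MY (urn_law_nonneg hW hZX0 huX) (urn_law_nonneg hW hZY0 huY) (urn_law_sum_eq_one hZX hZX0 huX)
      (urn_law_sum_eq_one hZY hZY0 huY) hMX hMY]
    have h := urn_gain_ge_min hΔ hW hp hZX hZY hZX0 hZY0 huX huY htot
    linarith
  have hΔ0 : 0 ≤ (Δ NX NY : ℝ) := Nat.cast_nonneg _
  have hmX := theta_mass_le hW hp0 hp hθ NX
  have hmY := theta_mass_le hW hp0 hp hθ NY
  have hfresh := theta_fresh_le hW hp0 hp hθ hμ0 hμ1 hμW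
  have hθm := theta_mem hW hp0 hp hθ
  have hfresh0 : 0 ≤ ∑ v, μ0 v * θ v := sum_nonneg fun v _ => mul_nonneg (hμ0 v) (by linarith [(hθm v).1])
  have hmin0 : 0 < min ZX ZY := lt_min hZX0 hZY0
  -- per copy: `(p/Z)·M + R = 1`, and `p/min Z ≥ p/Z`
  have hRX : ∑ a, uX a * θ a = (∑ v, θ v * (NX v : ℝ) / W v) / ZX := by
    rw [sum_div]; exact sum_congr rfl fun v _ => by rw [huX]; ring
  have hRY : ∑ b, uY b * θ b = (∑ v, θ v * (NY v : ℝ) / W v) / ZY := by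
    rw [sum_div]; exact sum_congr rfl fun v _ => by rw [huY]; ring
  have hX1 : p / ZX * ∑ v, θ v * (NX v : ℝ) + ∑ a, uX a * θ a = 1 := by
    rw [hRX]
    have h := urn_pM_add_R hW hp0 hθ NX
    rw [← hZX] at h
    field_simp
    linarith
  have hY1 : p / ZY * ∑ v, θ v * (NY v : ℝ) + ∑ b, uY b * θ b = 1 := by
    rw [hRY]
    have h := urn_pM_add_R hW hp0 hθ NY
    rw [← hZY] at h
    field_simp
    linarith
  -- `G·(M_X + M_Y) ≥ pΔ (M_X/Z_X + M_Y/Z_Y)`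
  have hGM : p * (Δ NX NY : ℝ) * (∑ v, θ v * (NX v : ℝ)) / ZX + p * (Δ NX NY : ℝ) * (∑ v, θ v * (NY v : ℝ)) / ZY
      ≤ ((Δ NX NY : ℝ) - ∑ a, ∑ b, optimalCoupling uX uY a b * (Δ (MX a) (MY b) : ℝ)) * (∑ v, θ v * (NX v : ℝ) + ∑ v, θ v * (NY v : ℝ)) := by
    have h1 : p * (Δ NX NY : ℝ) * (∑ v, θ v * (NX v : ℝ)) / ZX ≤ p * (Δ NX NY : ℝ) / min ZX ZY * ∑ v, θ v * (NX v : ℝ) := by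
      have hd : (∑ v, θ v * (NX v : ℝ)) / ZX ≤ (∑ v, θ v * (NX v : ℝ)) / min ZX ZY :=
        div_le_div_of_nonneg_left hmX.1 hmin0 (min_le_left _ _)
      calc p * (Δ NX NY : ℝ) * (∑ v, θ v * (NX v : ℝ)) / ZX = (p * (Δ NX NY : ℝ)) * ((∑ v, θ v * (NX v : ℝ)) / ZX) := by ring
        _ ≤ (p * (Δ NX NY : ℝ)) * ((∑ v, θ v * (NX v : ℝ)) / min ZX ZY) := mul_le_mul_of_nonneg_left hd (mul_nonneg hp0 hΔ0)
        _ = p * (Δ NX NY : ℝ) / min ZX ZY * ∑ v, θ v * (NX v : ℝ) := by ring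
    have h2 : p * (Δ NX NY : ℝ) * (∑ v, θ v * (NY v : ℝ)) / ZY ≤ p * (Δ NX NY : ℝ) / min ZX ZY * ∑ v, θ v * (NY v : ℝ) := by
      have hd : (∑ v, θ v * (NY v : ℝ)) / ZY ≤ (∑ v, θ v * (NY v : ℝ)) / min ZX ZY :=
        div_le_div_of_nonneg_left hmY.1 hmin0 (min_le_right _ _)
      calc p * (Δ NX NY : ℝ) * (∑ v, θ v * (NY v : ℝ)) / ZY = (p * (Δ NX NY : ℝ)) * ((∑ v, θ v * (NY v : ℝ)) / ZY) := by ring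
        _ ≤ (p * (Δ NX NY : ℝ)) * ((∑ v, θ v * (NY v : ℝ)) / min ZX ZY) := mul_le_mul_of_nonneg_left hd (mul_nonneg hp0 hΔ0)
        _ = p * (Δ NX NY : ℝ) / min ZX ZY * ∑ v, θ v * (NY v : ℝ) := by ring
    have h3 : p * (Δ NX NY : ℝ) / min ZX ZY * (∑ v, θ v * (NX v : ℝ) + ∑ v, θ v * (NY v : ℝ))
        ≤ ((Δ NX NY : ℝ) - ∑ a, ∑ b, optimalCoupling uX uY a b * (Δ (MX a) (MY b) : ℝ)) * (∑ v, θ v * (NX v : ℝ) + ∑ v, θ v * (NY v : ℝ)) :=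
      mul_le_mul_of_nonneg_right hG (by linarith [hmX.1, hmY.1])
    nlinarith [h1, h2, h3]
  -- `G·(2 + e − 2) ≥ 0`
  have hGe : 0 ≤ ((Δ NX NY : ℝ) - ∑ a, ∑ b, optimalCoupling uX uY a b * (Δ (MX a) (MY b) : ℝ)) * (2 * ∑ v, μ0 v * θ v) := by
    refine mul_nonneg (le_trans ?_ hG) (by linarith)
    exact div_nonneg (mul_nonneg hp0 hΔ0) hmin0.le
  -- `Φ ≤ 2K + 4`
  have hΦ : 2 + ∑ v, θ v * (NX v : ℝ) + ∑ v, θ v * (NY v : ℝ) ≤ 2 * K + 4 := by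
    have hx : ∑ v, (NX v : ℝ) = K + 1 := by exact_mod_cast hKX
    have hy : ∑ v, (NY v : ℝ) = K + 1 := by exact_mod_cast hKY
    linarith [hmX.2, hmY.2]
  have hK0 : (0 : ℝ) < 2 * K + 4 := by positivity
  -- assemble: left side `≤ pΔ`, right side `≥ pΔ`
  have hL : p / (2 * K + 4) * (Δ NX NY : ℝ) * (2 + ∑ v, θ v * (NX v : ℝ) + ∑ v, θ v * (NY v : ℝ)) ≤ p * (Δ NX NY : ℝ) := by
    rw [div_mul_eq_mul_div, div_mul_eq_mul_div, div_le_iff₀ hK0]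
    exact mul_le_mul_of_nonneg_left hΦ (mul_nonneg hp0 hΔ0)
  have hR : p * (Δ NX NY : ℝ) ≤ ((Δ NX NY : ℝ) - ∑ a, ∑ b, optimalCoupling uX uY a b * (Δ (MX a) (MY b) : ℝ))
          * ((2 + ∑ v, θ v * (NX v : ℝ) + ∑ v, θ v * (NY v : ℝ)) + 2 * ∑ v, μ0 v * θ v - 2 * 1)
        + (Δ NX NY : ℝ) * (∑ a, uX a * θ a + ∑ b, uY b * θ b - 2 * ∑ v, μ0 v * θ v) := by
    -- `Δ·(R_X + R_Y) = Δ·(2 − pM_X/Z_X − pM_Y/Z_Y)`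
    have hsum : (Δ NX NY : ℝ) * (∑ a, uX a * θ a + ∑ b, uY b * θ b)
        = 2 * (Δ NX NY : ℝ) - (p * (Δ NX NY : ℝ) * (∑ v, θ v * (NX v : ℝ)) / ZX + p * (Δ NX NY : ℝ) * (∑ v, θ v * (NY v : ℝ)) / ZY) := by
      have eX : ∑ a, uX a * θ a = 1 - p / ZX * ∑ v, θ v * (NX v : ℝ) := by linarith
      have eY : ∑ b, uY b * θ b = 1 - p / ZY * ∑ v, θ v * (NY v : ℝ) := by linarith
      rw [eX, eY]
      field_simp
      ring
    have hfr : (Δ NX NY : ℝ) * (2 * ∑ v, μ0 v * θ v) ≤ (Δ NX NY : ℝ) * (2 * (1 - p / 2)) :=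
      mul_le_mul_of_nonneg_left (by linarith) hΔ0
    nlinarith [hGM, hGe, hsum, hfr]
  exact hL.trans hR

/-! ## §3 The certificate -/

/-- **THE LAW-FREE MULTIPLICATIVE CERTIFICATE OF THE URN.**  For every finite content type, weights `W > 0` with `p·W ≤ 1` (`0 ≤ p`), hot law `μ_0` with `Σ μ_0 W = 1`,
and every pair of compositions with `K + 1` particles each: under the optimal coupling of the two deletions (common insertion),
`E[Δ(survivors)·(Φ + e − θ_a − θ_b)] ≤ (1 − p/(2K+4))·Δ(N_X,N_Y)·Φ`, `Φ = 2 + Σ θ(N_X + N_Y)`, `θ = 1/(1+pW)`, `e = 2Σ μ_0 θ`. [ours] -/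
theorem urn_product_certificate (hΔ : ∀ N N', Δ N N' = ∑ v, (N v - N' v)) (MX MY : S → S → ℕ) (hW : ∀ v, 0 < W v) (hp0 : 0 ≤ p) (hp : ∀ v, p * W v ≤ 1)
    (hθ : ∀ v, θ v = 1 / (1 + p * W v)) (hμ0 : ∀ v, 0 ≤ μ0 v) (hμ1 : ∑ v, μ0 v = 1) (hμW : ∑ v, μ0 v * W v = 1)
    (hZX : ZX = ∑ v, (NX v : ℝ) / W v) (hZY : ZY = ∑ v, (NY v : ℝ) / W v) (hZX0 : 0 < ZX) (hZY0 : 0 < ZY)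
    (huX : ∀ v, uX v = (NX v : ℝ) / W v / ZX) (huY : ∀ v, uY v = (NY v : ℝ) / W v / ZY) {K : ℕ} (hKX : ∑ v, NX v = K + 1) (hKY : ∑ v, NY v = K + 1)
    (hMX : ∀ a, uX a ≠ 0 → NX = MX a + Pi.single a 1) (hMY : ∀ b, uY b ≠ 0 → NY = MY b + Pi.single b 1) :
    ∑ a, ∑ b, optimalCoupling uX uY a b * ((Δ (MX a) (MY b) : ℝ)
        * ((2 + ∑ v, θ v * (NX v : ℝ) + ∑ v, θ v * (NY v : ℝ)) + 2 * ∑ v, μ0 v * θ v - θ a - θ b))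
      ≤ (1 - p / (2 * K + 4)) * (Δ NX NY : ℝ) * (2 + ∑ v, θ v * (NX v : ℝ) + ∑ v, θ v * (NY v : ℝ)) := by
  have hθm := theta_mem hW hp0 hp hθ
  have hcrit := urn_product_criterion hΔ MX MY hW hp0 hp hθ hμ0 hμ1 hμW hZX hZY hZX0 hZY0 huX huY hKX hKY hMX hMY
  have h := urn_product_contract hΔ MX MY hW hZX hZY hZX0 hZY0 huX huY hMX hMY θ (2 + ∑ v, θ v * (NX v : ℝ) + ∑ v, θ v * (NY v : ℝ))
    (2 * ∑ v, μ0 v * θ v) 1 (p / (2 * K + 4)) (fun v => by linarith [(hθm v).1]) (fun v => (hθm v).2) hcrit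
  exact h

omit [DecidableEq S] in
/-- `Δ ≤ Δ·Φ ≤ (2K+4)·Δ`: the product potential is sandwiched by the composition distance. [ours] -/
theorem urn_product_sandwich (hW : ∀ v, 0 < W v) (hp0 : 0 ≤ p) (hp : ∀ v, p * W v ≤ 1) (hθ : ∀ v, θ v = 1 / (1 + p * W v))
    {K : ℕ} (hKX : ∑ v, NX v = K + 1) (hKY : ∑ v, NY v = K + 1) (D : ℝ) (hD : 0 ≤ D) :
    D ≤ D * (2 + ∑ v, θ v * (NX v : ℝ) + ∑ v, θ v * (NY v : ℝ)) ∧ D * (2 + ∑ v, θ v * (NX v : ℝ) + ∑ v, θ v * (NY v : ℝ)) ≤ (2 * K + 4) * D := by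
  have hmX := theta_mass_le hW hp0 hp hθ NX
  have hmY := theta_mass_le hW hp0 hp hθ NY
  have hx : ∑ v, (NX v : ℝ) = K + 1 := by exact_mod_cast hKX
  have hy : ∑ v, (NY v : ℝ) = K + 1 := by exact_mod_cast hKY
  constructor
  · nlinarith [hmX.1, hmY.1]
  · nlinarith [hmX.2, hmY.2, hmX.1, hmY.1]

end UrnProduct

end Summit.Ventures.LatticeQCDFlow.Scaling
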